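import Summits.QuantumFields.BalabanUV.Beta.FP.StepRecursionFeed
import Summits.QuantumFields.BalabanUV.Beta.FP.TransportFineFactor

/-!
# `BalabanUV.Beta.FP.StepRecursionFeedNested` — road «FP» for binder row D1, ROUTE T, TID § F.13 «(L2′) `hF` ONE STOREY UP»: **THE FINE IDENTIFICATION AT
# EVERY STOREY `j + 1 ≥ 2` IS THE TRANSPORT OF THE STOREY BELOW's ONE-SHOT IDENTIFICATION** — #28 `StepRecursionFeed` §1∕§4 with the (L2′) letter `hF`
# SPLIT into its `j = 1` member and, for `j + 1 ≥ 2`, a TRANSPORT clause through the step weight `w (j+1)` composed with `hN` at storey `j`; and the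
# transport clause itself DELIVERED at one storey, in #28's currency, by leaf-02's TRANSPORT′ (`TransportFineFactor`) from the NESTED NAMINGS of the fine
# system's jets (displayed), the top step's column in an4's bond units (displayed) and the tadpole-freeness of the storey below (displayed)

WHY (TID § F.13 ∕ § F.16 «(L2′) `hF` (OWNER, § F.13 one storey up)»; an2 R-D1-g49-2 l.54833: `hG` (every `j`) and `hF` AT `j = 1` wait on (TAB); SPEC #42 (5)).
#28 §4 `stepRecursion_of_hessKer_laws` wants per `j ≥ 1` the fine identification `hF : 𝒦F j a b z = Lc⁸·dressedEntry (w j) (𝒯 j) (Lc•z) a b`.  At `j + 1 ≥ 2`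
the fine system of the storey-`(j+1)` door (#41d's `F`: the depth-`(j+1)` one-shot composite below the top step) IS the one-shot system of the storey-`j` door
(#41d's `N` one storey down) read along the NEW top step's directions: its lattice jets along a top bond are the storey-below jets pushed through the top step's
minimiser column (chain rule; the (C1) nesting `colH A_N = colH A_F ⋆ colH A_G`, an2 SPEC S-an2-g49-1 §2 BINDINGS), plus the `ψ̈`-word of the column's second
response.  HENCE `hF (j+1)` = TRANSPORT′ ∘ `hN j`: leaf-02 g15's `TransportFineFactor.hessKer_nest_add_eq_transport_of_tadpoleFree` turns the nested one-loop
kernel into `dressedEntry (colOf C) (hessKer A_F V₁ W₁) (Lc•z)` (the `ψ̈`-word dying on a tadpole-free storey below, R-FP-46), `hN j` names the inner kernel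
`𝒯 (j+1) = TshotOf (j+1)`, and a units letter `colOf C = c_w • w (j+1)` produces `c_w²·dressedEntry (w (j+1)) …` by `dressedEntry_const_mul` (quadratic in the
weight, one factor per leg) — #28's `Lc⁸` exactly when the (C1) normalisation delivers `c_w = Lc⁴` (an4's `StepDriftWitness.bondW` shape: `bondW Lc j = Lc⁴ • wStep
Lc j = R̂_j`; whether the rooted co-dressed top-step chart's column IS that in the tower's units is the row's ∕ an4's letter, DISPLAYED here).  So the (L2′) letter list per storey `j + 1 ≥ 2`
is: `hN` (an2, (C1)∕`tabsComp`), `hG` (an2, (C2) + (TAB)), the NESTED NAMINGS + UNITS + TAD of this file's §2 (an2 (C1) ∕ an4 ∕ the Ward row) — and `hF` proper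
survives ONLY at `j = 1` (the anchor storey, where (TAB_0) lives) — and even it is a transport of `hN 0` once the bottom step is read as the depth-1 one-shot
system (the `_anchored` variants).  Presentation-AGNOSTIC: every kernel, jet family, column and weight below is abstract.

CONTENT ([folklore]; no `def`, no `def … : Prop`, nothing cited, 0 sorry; `d + 1 = 4`):
* §1 KERNEL-ENTRY ∕ `hessKer` LEVEL — **`fineId_of_transport_of_oneShotId`** (`hN j` + the transport clause at `j+1` ⟹ `hF (j+1)` in #28's shape);
  **`stepRecursion_of_kernel_laws_nested`** (#28 §1 with `hF` split: `hF₁` at `j = 1` + `htr : ∀ j ≥ 1, 𝒦F (j+1) = Lc⁸·dressedEntry (w (j+1)) (𝒦N j) (Lc•·)`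
  ⟹ `StepRecursion Lc T 𝒯 w`); `stepRecursionUpTo_of_kernel_laws_nested` (the priced branch, R-FP-56 (b)); **`stepRecursion_of_hessKer_laws_nested`** (#28 §4's
  twin: three independent `hessKer` systems per `j`, the transport clause reading the storey-below `N` system's `hessKer`); and THE ANCHOR FOLDED IN —
  **`stepRecursion_of_kernel_laws_anchored`** (+`UpTo`), **`stepRecursion_of_hessKer_laws_anchored`**: `hN` and the transport clause supplied FROM STOREY `0` ON
  (`𝒦N 0` = the bottom step read as the depth-1 one-shot system, `hN 0 : 𝒦N 0 = 𝒯 1` — where the anchor `TshotOf Jc 1 = TbalOf Js 0` and (TAB_0) live) ⟹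
  NO separate `hF` at all: the fine identification IS a transport at every storey `j + 1 ≥ 1`.
* §2 THE TRANSPORT CLAUSE AT ONE STOREY — **`fineId_of_nested_namings`**: leaf-02's TRANSPORT′ hypotheses VERBATIM (spread `Lᶠ`-periodic fine leg `A_F`, column
  kernel `C` decaying + `Lc`-block covariant with `AbsMoment₂` columns, storey-below jets `V₁ W₁` bi-localised at `Lᶠ•u` and translation covariant, the `ψ̈`-weights
  decaying from a point, TAD `tadpole A_F (V₁ κ u) = 0`) + the NESTED NAMINGS `𝒱F = vertexOfK C Lc V₁`, `𝒲F = vertex2OfK C Lc W₁ + Σ_κ wsum (ψ₂ … κ) (V₁ κ)`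
  + UNITS `colOf C = fun κ l p => c_w * w κ l p` + the storey-below identification `hessKer A_F V₁ W₁ = 𝒯ⱼ` ⊢
  `hessKer A_F 𝒱F 𝒲F μ ν z = c_w² · dressedEntry w 𝒯ⱼ (Lc•z) μ ν`; `fineId_of_nested_namings_pure` (no `ψ̈`-word, no TAD: `TransportFineFactor.hessKer_nest_eq_dressedEntry`);
  and the BOND-UNIT corollaries `…_bondUnits` (`c_w = Lc⁴` ⊢ #28's `Lc⁸·dressedEntry w 𝒯ⱼ (Lc•z) μ ν` on the nose).
WHAT STAYS DISPLAYED (holders): the nested namings and the chart consistency across storeys `A_F^{(j+1)} = A_N^{(j)}` (an2 (C1): `CompositeOneShotChart` ✓, F3–F6);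
the units letter (an2 ∕ an4: the rooted co-dressed top-step column vs `wStep`); TAD of the composite one-shot system (the Ward ∕ criticality row); `hN`, `hG`; `hF₁`.
NOT HERE: (TAB), the namings, any decay constant, #21's rows; NOT (T-ID), NOT SDF, NOT D1, NOT BetaPertH, NOT continuum, NOT Clay.

HONEST DEPENDENCY (page 1, mandatory): continuum YM on T⁴ ⇐ BetaPertH ∧ nine spine estimates (0/9 proved); BetaPertH ⇐ (D1) ∧ (D4) ∧ CAP+tail;
G-an2-4 gates asym, D1 and NE2/3/4.  HONEST FRAMING (cell contract, verbatim): «discharging `BetaPertH` makes Bałaban's UV stability UNCONDITIONAL —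
a real constructive-QFT result; it is NOT the continuum limit and NOT the Clay problem.»  ABSOLUTE RULE (cell charter, verbatim): «No internally-minted
statement may enter as a cited fact. Every hypothesis is either kernel-proved in this package or a verbatim quotation of a PUBLISHED theorem with page
reference. The manuscript(s) under audit are NOT citable for their own disputed steps — they are the thing under adjudication; programme-internal
(2001/route/tribunal) claims are never citable.»  [folklore] bookkeeping + ONE application of leaf-02's TRANSPORT′ BY NAME; nothing of Bałaban's asserted;
0 estimates; 0∕4 row-D1 binders (hW, hR, D1Tel, D1Rep — every row above stays a hypothesis; `StepRecursion` is concluded ONLY from them); NOT (C1), NOT (L2′)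
discharged, NOT (T-ID), NOT SDF, NOT D1, NOT BetaPertH, NOT continuum, NOT Clay.  Road «FP» OWNER, b2b-balaban-beta-d1-p3 gen 28, 2026-08-23.  No existing file touched.
-/

noncomputable section

namespace Summit.QuantumFields.BalabanUV.Beta.FP.StepRecursionFeedNested

open scoped BigOperators
open Literature.MathematicalPhysics.QuantumFieldTheory.Balaban1983to89
open Literature.MathematicalPhysics.QuantumFieldTheory.Balaban1983to89.Beta
open B12Sec2to5 (l1)
open DecimatedMomentSummable (AbsMoment₂)
open DressedMomentNormalisation (EKer dressedEntry)
open ExpKernelCalculus (Site MKer Decays BiLoc tadpole hessKer shiftK)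
open OneStepResolventKernel (Fib wsum)
open OneStepKernelFamily (vertexOfK)
open SecondOrderResponse (vertex2OfK)
open HessianTelescopingKKT (StepRecursion StepRecursionUpTo)
open StepDriftWitness (dressedEntry_const_mul)
open Summit.QuantumFields.BalabanUV.Beta.TameKernelCalculus (Spr)
open Summit.QuantumFields.BalabanUV.Beta.FP.TransportInfinityM (colOf)
open Summit.QuantumFields.BalabanUV.Beta.FP.StepRecursionFeed (stepRecursion_of_kernel_laws stepRecursionUpTo_of_kernel_laws)
open Summit.QuantumFields.BalabanUV.Beta.FP.TransportFineFactor (hessKer_nest_eq_dressedEntry hessKer_nest_add_eq_transport_of_tadpoleFree)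

/-! ## §1 Kernel-entry and `hessKer` level: `hF` split into its anchor member and the transport of `hN` one storey down -/

section Entry

variable {Lc : ℕ} {T 𝒯 : ℕ → EKer 4} {w : ℕ → EKer 4}

/-- [folklore] **`hF` ONE STOREY UP.**  If the storey-`j` one-shot kernel identifies the depth-`(j+1)` composite (`hN j : 𝒦N j = 𝒯 (j+1)`) and the storey-`(j+1)`
fine kernel is the transport of `𝒦N j` through the step weight `w (j+1)` (the TRANSPORT clause), then the fine identification of #28 holds at `j + 1`:
`𝒦F (j+1) a b z = Lc⁸·dressedEntry (w (j+1)) (𝒯 (j+1)) (Lc•z) a b`. -/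
theorem fineId_of_transport_of_oneShotId (𝒦N 𝒦F : ℕ → EKer 4) (j : ℕ)
    (hN : ∀ (a b : Fin 4) (z : Fin 4 → ℤ), 𝒦N j a b z = 𝒯 (j + 1) a b z)
    (htr : ∀ (a b : Fin 4) (z : Fin 4 → ℤ), 𝒦F (j + 1) a b z = (Lc : ℝ) ^ 8 * dressedEntry (w (j + 1)) (𝒦N j) ((Lc : ℤ) • z) a b) :
    ∀ (a b : Fin 4) (z : Fin 4 → ℤ), 𝒦F (j + 1) a b z = (Lc : ℝ) ^ 8 * dressedEntry (w (j + 1)) (𝒯 (j + 1)) ((Lc : ℤ) • z) a b := by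
  have h : 𝒦N j = 𝒯 (j + 1) := funext fun a => funext fun b => funext fun z => hN a b z
  intro a b z
  rw [htr a b z, h]

/-- [folklore] **THE (F1) SOCKET AT KERNEL-ENTRY LEVEL, NESTED FORM.**  Per `j ≥ 1` the de-periodised door `𝒦N j = 𝒦F j + 𝒦G j` (L1), the one-shot
identification `hN`, the top-step identification `hG`; the fine identification ONLY at the anchor storey `j = 1` (`hF₁`); and for every `j ≥ 1` the TRANSPORT
clause `𝒦F (j+1) a b z = Lc⁸·dressedEntry (w (j+1)) (𝒦N j) (Lc•z) a b` (the storey-`(j+1)` fine system is the storey-`j` one-shot system transported) ⟹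
an4's `StepRecursion Lc T 𝒯 w` (#28 §1 `stepRecursion_of_kernel_laws` with `hF (j+2) := fineId_of_transport_of_oneShotId`). -/
theorem stepRecursion_of_kernel_laws_nested (𝒦N 𝒦F 𝒦G : ℕ → EKer 4)
    (hlaw : ∀ j : ℕ, 1 ≤ j → ∀ (a b : Fin 4) (z : Fin 4 → ℤ), 𝒦N j a b z = 𝒦F j a b z + 𝒦G j a b z)
    (hN : ∀ j : ℕ, 1 ≤ j → ∀ (a b : Fin 4) (z : Fin 4 → ℤ), 𝒦N j a b z = 𝒯 (j + 1) a b z)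
    (hF₁ : ∀ (a b : Fin 4) (z : Fin 4 → ℤ), 𝒦F 1 a b z = (Lc : ℝ) ^ 8 * dressedEntry (w 1) (𝒯 1) ((Lc : ℤ) • z) a b)
    (htr : ∀ j : ℕ, 1 ≤ j → ∀ (a b : Fin 4) (z : Fin 4 → ℤ),
      𝒦F (j + 1) a b z = (Lc : ℝ) ^ 8 * dressedEntry (w (j + 1)) (𝒦N j) ((Lc : ℤ) • z) a b)
    (hG : ∀ j : ℕ, 1 ≤ j → ∀ (a b : Fin 4) (z : Fin 4 → ℤ), 𝒦G j a b z = T j a b z) :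
    StepRecursion Lc T 𝒯 w := by
  refine stepRecursion_of_kernel_laws 𝒦N 𝒦F 𝒦G hlaw hN ?_ hG
  intro j hj
  match j, hj with
  | 1, _ => exact hF₁
  | j + 2, _ => exact fineId_of_transport_of_oneShotId 𝒦N 𝒦F (j + 1) (hN (j + 1) (Nat.succ_pos j)) (htr (j + 1) (Nat.succ_pos j))

/-- [folklore] **THE PRICED BRANCH (R-FP-56 (b)), NESTED FORM**: the same with an explicit door defect family `D j` (`𝒦N = 𝒦F + 𝒦G + D`) ⟹ `StepRecursionUpTo Lc T 𝒯 w D`. -/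
theorem stepRecursionUpTo_of_kernel_laws_nested (𝒦N 𝒦F 𝒦G D : ℕ → EKer 4)
    (hlaw : ∀ j : ℕ, 1 ≤ j → ∀ (a b : Fin 4) (z : Fin 4 → ℤ), 𝒦N j a b z = 𝒦F j a b z + 𝒦G j a b z + D j a b z)
    (hN : ∀ j : ℕ, 1 ≤ j → ∀ (a b : Fin 4) (z : Fin 4 → ℤ), 𝒦N j a b z = 𝒯 (j + 1) a b z)
    (hF₁ : ∀ (a b : Fin 4) (z : Fin 4 → ℤ), 𝒦F 1 a b z = (Lc : ℝ) ^ 8 * dressedEntry (w 1) (𝒯 1) ((Lc : ℤ) • z) a b)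
    (htr : ∀ j : ℕ, 1 ≤ j → ∀ (a b : Fin 4) (z : Fin 4 → ℤ),
      𝒦F (j + 1) a b z = (Lc : ℝ) ^ 8 * dressedEntry (w (j + 1)) (𝒦N j) ((Lc : ℤ) • z) a b)
    (hG : ∀ j : ℕ, 1 ≤ j → ∀ (a b : Fin 4) (z : Fin 4 → ℤ), 𝒦G j a b z = T j a b z) :
    StepRecursionUpTo Lc T 𝒯 w D := by
  refine stepRecursionUpTo_of_kernel_laws 𝒦N 𝒦F 𝒦G D hlaw hN ?_ hG
  intro j hj
  match j, hj with
  | 1, _ => exact hF₁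
  | j + 2, _ => exact fineId_of_transport_of_oneShotId 𝒦N 𝒦F (j + 1) (hN (j + 1) (Nat.succ_pos j)) (htr (j + 1) (Nat.succ_pos j))

/-- [folklore] **THE ANCHOR FOLDED IN: `hF` IS A TRANSPORT AT EVERY STOREY.**  If the one-shot identification is supplied from storey `0` on
(`hN 0 : 𝒦N 0 = 𝒯 1` — the BOTTOM STEP read as the depth-1 one-shot system; at the record this is where the anchor `TshotOf Jc 1 = TbalOf Js 0` and
(TAB_0) live) and the transport clause from storey `0` on, then NO separate fine identification is needed: #28 §1 with `hF (j+1) := transport ∘ hN j` for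
every `j ≥ 0`. -/
theorem stepRecursion_of_kernel_laws_anchored (𝒦N 𝒦F 𝒦G : ℕ → EKer 4)
    (hlaw : ∀ j : ℕ, 1 ≤ j → ∀ (a b : Fin 4) (z : Fin 4 → ℤ), 𝒦N j a b z = 𝒦F j a b z + 𝒦G j a b z)
    (hN : ∀ (j : ℕ) (a b : Fin 4) (z : Fin 4 → ℤ), 𝒦N j a b z = 𝒯 (j + 1) a b z)
    (htr : ∀ (j : ℕ) (a b : Fin 4) (z : Fin 4 → ℤ),
      𝒦F (j + 1) a b z = (Lc : ℝ) ^ 8 * dressedEntry (w (j + 1)) (𝒦N j) ((Lc : ℤ) • z) a b)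
    (hG : ∀ j : ℕ, 1 ≤ j → ∀ (a b : Fin 4) (z : Fin 4 → ℤ), 𝒦G j a b z = T j a b z) :
    StepRecursion Lc T 𝒯 w := by
  refine stepRecursion_of_kernel_laws 𝒦N 𝒦F 𝒦G hlaw (fun j _ => hN j) ?_ hG
  intro j hj
  match j, hj with
  | j + 1, _ => exact fineId_of_transport_of_oneShotId 𝒦N 𝒦F j (hN j) (htr j)

/-- [folklore] The priced branch with the anchor folded in. -/
theorem stepRecursionUpTo_of_kernel_laws_anchored (𝒦N 𝒦F 𝒦G D : ℕ → EKer 4)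
    (hlaw : ∀ j : ℕ, 1 ≤ j → ∀ (a b : Fin 4) (z : Fin 4 → ℤ), 𝒦N j a b z = 𝒦F j a b z + 𝒦G j a b z + D j a b z)
    (hN : ∀ (j : ℕ) (a b : Fin 4) (z : Fin 4 → ℤ), 𝒦N j a b z = 𝒯 (j + 1) a b z)
    (htr : ∀ (j : ℕ) (a b : Fin 4) (z : Fin 4 → ℤ),
      𝒦F (j + 1) a b z = (Lc : ℝ) ^ 8 * dressedEntry (w (j + 1)) (𝒦N j) ((Lc : ℤ) • z) a b)
    (hG : ∀ j : ℕ, 1 ≤ j → ∀ (a b : Fin 4) (z : Fin 4 → ℤ), 𝒦G j a b z = T j a b z) :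
    StepRecursionUpTo Lc T 𝒯 w D := by
  refine stepRecursionUpTo_of_kernel_laws 𝒦N 𝒦F 𝒦G D hlaw (fun j _ => hN j) ?_ hG
  intro j hj
  match j, hj with
  | j + 1, _ => exact fineId_of_transport_of_oneShotId 𝒦N 𝒦F j (hN j) (htr j)

end Entry

section HessKer

variable {Lc : ℕ} {T 𝒯 : ℕ → EKer 4} {w : ℕ → EKer 4} {FN FF FG : Type*} [Fintype FN] [Fintype FF] [Fintype FG]

/-- [folklore] **THE (F1) SOCKET IN `hessKer` CURRENCY, NESTED FORM** (#28 §4's twin).  Per `j ≥ 1` three INDEPENDENT lattice one-loop systems whose `hessKer`s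
obey the de-periodised door (#42a `TowerKernelLaw.hessKer_law_tower`'s output shape, one storey each), the one-shot system identified with `𝒯 (j+1)`, the top
step with `T j`; the fine system identified with `Lc⁸·dressedEntry (w 1) (𝒯 1) (Lc•·)` AT `j = 1` ONLY, and for `j ≥ 1` the TRANSPORT clause reading the
storey-`j` one-shot system's `hessKer` (§2 delivers it from the nested namings) ⟹ `StepRecursion Lc T 𝒯 w`. -/
theorem stepRecursion_of_hessKer_laws_nested
    (AN : ℕ → MKer 4 FN) (𝒱N : ℕ → Fin 4 → (Fin 4 → ℤ) → MKer 4 FN) (𝒲N : ℕ → Fin 4 → (Fin 4 → ℤ) → Fin 4 → (Fin 4 → ℤ) → MKer 4 FN)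
    (AF : ℕ → MKer 4 FF) (𝒱F : ℕ → Fin 4 → (Fin 4 → ℤ) → MKer 4 FF) (𝒲F : ℕ → Fin 4 → (Fin 4 → ℤ) → Fin 4 → (Fin 4 → ℤ) → MKer 4 FF)
    (AG : ℕ → MKer 4 FG) (𝒱G : ℕ → Fin 4 → (Fin 4 → ℤ) → MKer 4 FG) (𝒲G : ℕ → Fin 4 → (Fin 4 → ℤ) → Fin 4 → (Fin 4 → ℤ) → MKer 4 FG)
    (hlaw : ∀ j : ℕ, 1 ≤ j → ∀ (μ ν : Fin 4) (z : Fin 4 → ℤ),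
      hessKer (AN j) (𝒱N j) (𝒲N j) μ ν z = hessKer (AF j) (𝒱F j) (𝒲F j) μ ν z + hessKer (AG j) (𝒱G j) (𝒲G j) μ ν z)
    (hN : ∀ j : ℕ, 1 ≤ j → ∀ (μ ν : Fin 4) (z : Fin 4 → ℤ), hessKer (AN j) (𝒱N j) (𝒲N j) μ ν z = 𝒯 (j + 1) μ ν z)
    (hF₁ : ∀ (μ ν : Fin 4) (z : Fin 4 → ℤ),
      hessKer (AF 1) (𝒱F 1) (𝒲F 1) μ ν z = (Lc : ℝ) ^ 8 * dressedEntry (w 1) (𝒯 1) ((Lc : ℤ) • z) μ ν)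
    (htr : ∀ j : ℕ, 1 ≤ j → ∀ (μ ν : Fin 4) (z : Fin 4 → ℤ),
      hessKer (AF (j + 1)) (𝒱F (j + 1)) (𝒲F (j + 1)) μ ν z
        = (Lc : ℝ) ^ 8 * dressedEntry (w (j + 1)) (hessKer (AN j) (𝒱N j) (𝒲N j)) ((Lc : ℤ) • z) μ ν)
    (hG : ∀ j : ℕ, 1 ≤ j → ∀ (μ ν : Fin 4) (z : Fin 4 → ℤ), hessKer (AG j) (𝒱G j) (𝒲G j) μ ν z = T j μ ν z) :
    StepRecursion Lc T 𝒯 w :=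
  stepRecursion_of_kernel_laws_nested (fun j => hessKer (AN j) (𝒱N j) (𝒲N j)) (fun j => hessKer (AF j) (𝒱F j) (𝒲F j))
    (fun j => hessKer (AG j) (𝒱G j) (𝒲G j)) hlaw hN hF₁ htr hG

/-- [folklore] **`hessKer` CURRENCY, THE ANCHOR FOLDED IN**: the one-shot systems supplied from storey `0` on (`AN 0, 𝒱N 0, 𝒲N 0` = the bottom step read as
the depth-1 one-shot system, `hN 0 : hessKer (AN 0) (𝒱N 0) (𝒲N 0) = 𝒯 1`), the transport clause from storey `0` on; no `hF₁`. -/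
theorem stepRecursion_of_hessKer_laws_anchored
    (AN : ℕ → MKer 4 FN) (𝒱N : ℕ → Fin 4 → (Fin 4 → ℤ) → MKer 4 FN) (𝒲N : ℕ → Fin 4 → (Fin 4 → ℤ) → Fin 4 → (Fin 4 → ℤ) → MKer 4 FN)
    (AF : ℕ → MKer 4 FF) (𝒱F : ℕ → Fin 4 → (Fin 4 → ℤ) → MKer 4 FF) (𝒲F : ℕ → Fin 4 → (Fin 4 → ℤ) → Fin 4 → (Fin 4 → ℤ) → MKer 4 FF)
    (AG : ℕ → MKer 4 FG) (𝒱G : ℕ → Fin 4 → (Fin 4 → ℤ) → MKer 4 FG) (𝒲G : ℕ → Fin 4 → (Fin 4 → ℤ) → Fin 4 → (Fin 4 → ℤ) → MKer 4 FG)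
    (hlaw : ∀ j : ℕ, 1 ≤ j → ∀ (μ ν : Fin 4) (z : Fin 4 → ℤ),
      hessKer (AN j) (𝒱N j) (𝒲N j) μ ν z = hessKer (AF j) (𝒱F j) (𝒲F j) μ ν z + hessKer (AG j) (𝒱G j) (𝒲G j) μ ν z)
    (hN : ∀ (j : ℕ) (μ ν : Fin 4) (z : Fin 4 → ℤ), hessKer (AN j) (𝒱N j) (𝒲N j) μ ν z = 𝒯 (j + 1) μ ν z)
    (htr : ∀ (j : ℕ) (μ ν : Fin 4) (z : Fin 4 → ℤ),
      hessKer (AF (j + 1)) (𝒱F (j + 1)) (𝒲F (j + 1)) μ ν z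
        = (Lc : ℝ) ^ 8 * dressedEntry (w (j + 1)) (hessKer (AN j) (𝒱N j) (𝒲N j)) ((Lc : ℤ) • z) μ ν)
    (hG : ∀ j : ℕ, 1 ≤ j → ∀ (μ ν : Fin 4) (z : Fin 4 → ℤ), hessKer (AG j) (𝒱G j) (𝒲G j) μ ν z = T j μ ν z) :
    StepRecursion Lc T 𝒯 w :=
  stepRecursion_of_kernel_laws_anchored (fun j => hessKer (AN j) (𝒱N j) (𝒲N j)) (fun j => hessKer (AF j) (𝒱F j) (𝒲F j))
    (fun j => hessKer (AG j) (𝒱G j) (𝒲G j)) hlaw hN htr hG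

end HessKer

/-! ## §2 The transport clause at one storey from the nested namings (leaf-02's TRANSPORT′ in #28's currency) -/

section Transport

variable {L : ℕ} [NeZero L] {Lc : ℕ}
  {AF C : MKer (3 + 1) (Fib 3)}
  {V₁ : Fin (3 + 1) → Site (3 + 1) → MKer (3 + 1) (Fib 3)}
  {W₁ : Fin (3 + 1) → Site (3 + 1) → Fin (3 + 1) → Site (3 + 1) → MKer (3 + 1) (Fib 3)}
  {𝒱F : Fin (3 + 1) → Site (3 + 1) → MKer (3 + 1) (Fib 3)}
  {𝒲F : Fin (3 + 1) → Site (3 + 1) → Fin (3 + 1) → Site (3 + 1) → MKer (3 + 1) (Fib 3)}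
  {w 𝒯j : EKer 4}

/-- [folklore] **THE TRANSPORT CLAUSE FROM THE NESTED NAMINGS, PURE FORM** (no `ψ̈`-word).  leaf-02's `TransportFineFactor.hessKer_nest_eq_dressedEntry` hypotheses
VERBATIM (fine leg `A_F` spread and `L`-periodic; the top step's column kernel `C` decaying, `Lc`-block covariant, `AbsMoment₂` columns; the storey-below jets
`V₁ W₁` bi-localised at `L•u` and translation covariant) + the NESTED NAMINGS `𝒱F = vertexOfK C Lc V₁`, `𝒲F = vertex2OfK C Lc W₁` + the UNITS letter
`colOf C = fun κ l p => c_w * w κ l p` (the top step's column as a multiple of the END's weight) + the storey-below identification `hessKer A_F V₁ W₁ = 𝒯ⱼ` ⊢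
`hessKer A_F 𝒱F 𝒲F μ ν z = c_w² · dressedEntry w 𝒯ⱼ (Lc•z) μ ν` (one factor `c_w` per leg). -/
theorem fineId_of_nested_namings_pure (hLc : 1 ≤ Lc) (hA : Spr AF) (hAcov : ∀ t : Site (3 + 1), shiftK (-((L : ℤ) • t)) AF = AF)
    {CC δ Cs δs C2 δ2 : ℝ}
    (hC : Decays C CC δ) (hδ : 0 < δ) (hCcov : ∀ t : Site (3 + 1), shiftK (-((Lc : ℤ) • t)) C = C)
    (hwA : ∀ κ l : Fin 4, AbsMoment₂ (colOf C κ l))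
    (hV : ∀ κ u, BiLoc (V₁ κ u) ((L : ℤ) • u) ((L : ℤ) • u) Cs δs) (hδs : 0 < δs)
    (hVcov : ∀ κ u t, V₁ κ (u + t) = shiftK (-((L : ℤ) • t)) (V₁ κ u))
    (hW : ∀ κ u l u', BiLoc (W₁ κ u l u') ((L : ℤ) • u) ((L : ℤ) • u') C2 δ2) (hδ2 : 0 < δ2)
    (hWcov : ∀ κ u l u' t, W₁ κ (u + t) l (u' + t) = shiftK (-((L : ℤ) • t)) (W₁ κ u l u'))
    -- THE NESTED NAMINGS (DISPLAYED; the (C1) chain rule through the top step's column)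
    (h𝒱F : 𝒱F = vertexOfK C Lc V₁) (h𝒲F : 𝒲F = vertex2OfK C Lc W₁)
    -- UNITS (DISPLAYED): the top step's column as a multiple `c_w` of the END's weight `w`
    (cw : ℝ) (hw : colOf C = fun κ l p => cw * w κ l p)
    -- THE STOREY BELOW's ONE-SHOT IDENTIFICATION (DISPLAYED; `hN` one storey down after the chart consistency `A_F = A_N⁻`)
    (hbelow : ∀ (μ ν : Fin (3 + 1)) (z : Site (3 + 1)), hessKer AF V₁ W₁ μ ν z = 𝒯j μ ν z)
    (μ ν : Fin (3 + 1)) (z : Site (3 + 1)) :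
    hessKer AF 𝒱F 𝒲F μ ν z = cw ^ 2 * dressedEntry w 𝒯j ((Lc : ℤ) • z) μ ν := by
  subst h𝒱F h𝒲F
  have hT : hessKer AF V₁ W₁ = 𝒯j := funext fun μ => funext fun ν => funext fun z => hbelow μ ν z
  rw [hessKer_nest_eq_dressedEntry (L := L) hLc hA hAcov hC hδ hCcov hwA hV hδs hVcov hW hδ2 hWcov μ ν z, hw, hT, dressedEntry_const_mul]

/-- [folklore] **THE TRANSPORT CLAUSE FROM THE NESTED NAMINGS** (with the column's second response).  As `fineId_of_nested_namings_pure`, the second-order naming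
now carrying the `ψ̈`-word `Σ_κ wsum (ψ₂ μ y ν y′ κ) (V₁ κ)` (the storey-below FIRST jets weighted by the top column's second response, decaying from a point) and
the storey below TADPOLE-FREE (`tadpole A_F (V₁ κ u) = 0`, the Ward ∕ criticality row — R-FP-46: the `T₁`-linear cross term dies):
leaf-02's `hessKer_nest_add_eq_transport_of_tadpoleFree` + UNITS + `hbelow` ⊢ `hessKer A_F 𝒱F 𝒲F μ ν z = c_w² · dressedEntry w 𝒯ⱼ (Lc•z) μ ν`. -/
theorem fineId_of_nested_namings (hLc : 1 ≤ Lc) (hA : Spr AF) (hAcov : ∀ t : Site (3 + 1), shiftK (-((L : ℤ) • t)) AF = AF)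
    {CC δ Cs δs C2 δ2 Cψ mψ : ℝ}
    (hC : Decays C CC δ) (hδ : 0 < δ) (hCcov : ∀ t : Site (3 + 1), shiftK (-((Lc : ℤ) • t)) C = C)
    (hwA : ∀ κ l : Fin 4, AbsMoment₂ (colOf C κ l))
    (hV : ∀ κ u, BiLoc (V₁ κ u) ((L : ℤ) • u) ((L : ℤ) • u) Cs δs) (hδs : 0 < δs)
    (hVcov : ∀ κ u t, V₁ κ (u + t) = shiftK (-((L : ℤ) • t)) (V₁ κ u))
    (hW : ∀ κ u l u', BiLoc (W₁ κ u l u') ((L : ℤ) • u) ((L : ℤ) • u') C2 δ2) (hδ2 : 0 < δ2)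
    (hWcov : ∀ κ u l u' t, W₁ κ (u + t) l (u' + t) = shiftK (-((L : ℤ) • t)) (W₁ κ u l u'))
    (ψ₂ : Fin (3 + 1) → Site (3 + 1) → Fin (3 + 1) → Site (3 + 1) → Fin (3 + 1) → Site (3 + 1) → ℝ) (hmψ : 0 < mψ)
    (hψ : ∀ μ y ν y' κ, ∃ p : Site (3 + 1), ∀ u, |ψ₂ μ y ν y' κ u| ≤ Cψ * Real.exp (-mψ * l1 (u - p)))
    -- TAD (DISPLAYED): the storey below is tadpole-free on the fine leg
    (htad : ∀ κ u, tadpole AF (V₁ κ u) = 0)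
    -- THE NESTED NAMINGS (DISPLAYED): chain rule through the top column at order 1; at order 2 the bi-transport plus the `ψ̈`-word
    (h𝒱F : 𝒱F = vertexOfK C Lc V₁)
    (h𝒲F : 𝒲F = vertex2OfK C Lc W₁ + fun μ y ν y' => fun x z' a b => ∑ κ, wsum (ψ₂ μ y ν y' κ) (V₁ κ) x z' a b)
    -- UNITS (DISPLAYED)
    (cw : ℝ) (hw : colOf C = fun κ l p => cw * w κ l p)
    -- THE STOREY BELOW's ONE-SHOT IDENTIFICATION (DISPLAYED)
    (hbelow : ∀ (μ ν : Fin (3 + 1)) (z : Site (3 + 1)), hessKer AF V₁ W₁ μ ν z = 𝒯j μ ν z)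
    (μ ν : Fin (3 + 1)) (z : Site (3 + 1)) :
    hessKer AF 𝒱F 𝒲F μ ν z = cw ^ 2 * dressedEntry w 𝒯j ((Lc : ℤ) • z) μ ν := by
  subst h𝒱F h𝒲F
  have hT : hessKer AF V₁ W₁ = 𝒯j := funext fun μ => funext fun ν => funext fun z => hbelow μ ν z
  rw [hessKer_nest_add_eq_transport_of_tadpoleFree (L := L) hLc hA hAcov hC hδ hCcov hwA hV hδs hVcov hW hδ2 hWcov ψ₂ hmψ hψ htad μ ν z,
    hw, hT, dressedEntry_const_mul]

/-- [folklore] **BOND UNITS** (`c_w = Lc⁴`, an4's `StepDriftWitness.bondW Lc j = Lc⁴ • wStep Lc j = R̂_j`): the pure transport clause lands on #28's `hF` shape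
`Lc⁸ · dressedEntry w 𝒯ⱼ (Lc•z) μ ν` on the nose (`(Lc⁴)² = Lc⁸`, one factor per leg). -/
theorem fineId_of_nested_namings_pure_bondUnits (hLc : 1 ≤ Lc) (hA : Spr AF) (hAcov : ∀ t : Site (3 + 1), shiftK (-((L : ℤ) • t)) AF = AF)
    {CC δ Cs δs C2 δ2 : ℝ}
    (hC : Decays C CC δ) (hδ : 0 < δ) (hCcov : ∀ t : Site (3 + 1), shiftK (-((Lc : ℤ) • t)) C = C)
    (hwA : ∀ κ l : Fin 4, AbsMoment₂ (colOf C κ l))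
    (hV : ∀ κ u, BiLoc (V₁ κ u) ((L : ℤ) • u) ((L : ℤ) • u) Cs δs) (hδs : 0 < δs)
    (hVcov : ∀ κ u t, V₁ κ (u + t) = shiftK (-((L : ℤ) • t)) (V₁ κ u))
    (hW : ∀ κ u l u', BiLoc (W₁ κ u l u') ((L : ℤ) • u) ((L : ℤ) • u') C2 δ2) (hδ2 : 0 < δ2)
    (hWcov : ∀ κ u l u' t, W₁ κ (u + t) l (u' + t) = shiftK (-((L : ℤ) • t)) (W₁ κ u l u'))
    (h𝒱F : 𝒱F = vertexOfK C Lc V₁) (h𝒲F : 𝒲F = vertex2OfK C Lc W₁)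
    (hw : colOf C = fun κ l p => (Lc : ℝ) ^ 4 * w κ l p)
    (hbelow : ∀ (μ ν : Fin (3 + 1)) (z : Site (3 + 1)), hessKer AF V₁ W₁ μ ν z = 𝒯j μ ν z)
    (μ ν : Fin (3 + 1)) (z : Site (3 + 1)) :
    hessKer AF 𝒱F 𝒲F μ ν z = (Lc : ℝ) ^ 8 * dressedEntry w 𝒯j ((Lc : ℤ) • z) μ ν := by
  rw [fineId_of_nested_namings_pure (L := L) hLc hA hAcov hC hδ hCcov hwA hV hδs hVcov hW hδ2 hWcov h𝒱F h𝒲F ((Lc : ℝ) ^ 4) hw hbelow μ ν z]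
  ring

/-- [folklore] **BOND UNITS**, with the `ψ̈`-word and TAD: `c_w = Lc⁴` ⊢ #28's `hF` shape `Lc⁸ · dressedEntry w 𝒯ⱼ (Lc•z) μ ν` on the nose. -/
theorem fineId_of_nested_namings_bondUnits (hLc : 1 ≤ Lc) (hA : Spr AF) (hAcov : ∀ t : Site (3 + 1), shiftK (-((L : ℤ) • t)) AF = AF)
    {CC δ Cs δs C2 δ2 Cψ mψ : ℝ}
    (hC : Decays C CC δ) (hδ : 0 < δ) (hCcov : ∀ t : Site (3 + 1), shiftK (-((Lc : ℤ) • t)) C = C)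
    (hwA : ∀ κ l : Fin 4, AbsMoment₂ (colOf C κ l))
    (hV : ∀ κ u, BiLoc (V₁ κ u) ((L : ℤ) • u) ((L : ℤ) • u) Cs δs) (hδs : 0 < δs)
    (hVcov : ∀ κ u t, V₁ κ (u + t) = shiftK (-((L : ℤ) • t)) (V₁ κ u))
    (hW : ∀ κ u l u', BiLoc (W₁ κ u l u') ((L : ℤ) • u) ((L : ℤ) • u') C2 δ2) (hδ2 : 0 < δ2)
    (hWcov : ∀ κ u l u' t, W₁ κ (u + t) l (u' + t) = shiftK (-((L : ℤ) • t)) (W₁ κ u l u'))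
    (ψ₂ : Fin (3 + 1) → Site (3 + 1) → Fin (3 + 1) → Site (3 + 1) → Fin (3 + 1) → Site (3 + 1) → ℝ) (hmψ : 0 < mψ)
    (hψ : ∀ μ y ν y' κ, ∃ p : Site (3 + 1), ∀ u, |ψ₂ μ y ν y' κ u| ≤ Cψ * Real.exp (-mψ * l1 (u - p)))
    (htad : ∀ κ u, tadpole AF (V₁ κ u) = 0)
    (h𝒱F : 𝒱F = vertexOfK C Lc V₁)
    (h𝒲F : 𝒲F = vertex2OfK C Lc W₁ + fun μ y ν y' => fun x z' a b => ∑ κ, wsum (ψ₂ μ y ν y' κ) (V₁ κ) x z' a b)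
    (hw : colOf C = fun κ l p => (Lc : ℝ) ^ 4 * w κ l p)
    (hbelow : ∀ (μ ν : Fin (3 + 1)) (z : Site (3 + 1)), hessKer AF V₁ W₁ μ ν z = 𝒯j μ ν z)
    (μ ν : Fin (3 + 1)) (z : Site (3 + 1)) :
    hessKer AF 𝒱F 𝒲F μ ν z = (Lc : ℝ) ^ 8 * dressedEntry w 𝒯j ((Lc : ℤ) • z) μ ν := by
  rw [fineId_of_nested_namings (L := L) hLc hA hAcov hC hδ hCcov hwA hV hδs hVcov hW hδ2 hWcov ψ₂ hmψ hψ htad h𝒱F h𝒲F ((Lc : ℝ) ^ 4) hw hbelow μ ν z]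
  ring

end Transport

/-! ## §3 (v1.3, APPEND-ONLY; road «FP» OWNER gen 28) At M‴'s literal: `D1Tel` from the rows in ANCHORED form — #28 §5 `d1Tel_anchored_of_kernel_laws_wStep`
(any `Jc` anchored at `m = 1` on `JcOf`) with `hF` FOLDED into the transport of `hN`: `hlaw (j ≥ 1)`, `hN` from storey 0, the transport clause from storey 0 at
`w := wStep Lc`, `hG (j ≥ 1)`, (T0)(T1) ⟹ `D1Tel Lc (JsB12CombShSym …) Jc` = M‴'s `htel` binder — the road's END in ONE term (kernel-entry and `hessKer`
currencies).  [folklore]; nothing of Bałaban's asserted; every row a HYPOTHESIS; 0∕4 row-D1 binders; NOT (T-ID), NOT D1, NOT BetaPertH, NOT continuum, NOT Clay. -/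

section LiteralAnchored

variable {Lc : ℕ} [NeZero Lc]

open OneStepResolventKernel (JetData)
open OneStepKernelFamily (TbalOf TshotOf D1Tel)
open HessianTelescopingKKT (wStep)
open Summit.QuantumFields.BalabanUV.Beta.SymSecondOrderTablesAn1 (symTablesAn1S2)
open Summit.QuantumFields.BalabanUV.Beta.CombChartJointEnd (JsB12CombShSym)
open Summit.QuantumFields.BalabanUV.Beta.CombOneShotJets (JcOf)
open Summit.QuantumFields.BalabanUV.Beta.FP.StepRecursionFeed (d1Tel_anchored_of_kernel_laws_wStep)

/-- [folklore] **M‴'s `htel` FROM THE ROAD's ROWS IN ANCHORED FORM** (#28 §5 `d1Tel_anchored_of_kernel_laws_wStep` with `hF` FOLDED AWAY): for ANY composite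
family `Jc` anchored at `m = 1` on `JcOf` (R-D1-g42-4 (3)), the de-periodised door per `j ≥ 1`, the one-shot identification `𝒦N j = TshotOf Lc Jc (j+1)` FROM
STOREY `0`, the TRANSPORT clause `𝒦F (j+1) = Lc⁸·dressedEntry (wStep Lc (j+1)) (𝒦N j) (Lc•·)` FROM STOREY `0` (canonical weight), the top-step identification
`𝒦G j = TbalOf Lc Js j` (`j ≥ 1`) and (T0)(T1) of the step kernels ⟹ `D1Tel Lc (JsB12CombShSym hLc N (symTablesAn1S2 3 Lc cΛ) cΛ cB) Jc` — NO `hF`, `hbase`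
discharged by the anchor inside #28 §5. -/
theorem d1Tel_anchored_of_kernel_laws_anchored_wStep (hLc : Odd Lc) (N : ℕ) (cΛ cB : ℝ) (Jc : ∀ m : ℕ, JetData 3 (Lc ^ m))
    (hJc1 : Jc 1 = JcOf hLc N (fun _ => cΛ) (fun _ => cB) 1) (𝒦N 𝒦F 𝒦G : ℕ → EKer 4)
    (hlaw : ∀ j : ℕ, 1 ≤ j → ∀ (a b : Fin 4) (z : Fin 4 → ℤ), 𝒦N j a b z = 𝒦F j a b z + 𝒦G j a b z)
    (hN : ∀ (j : ℕ) (a b : Fin 4) (z : Fin 4 → ℤ), 𝒦N j a b z = TshotOf Lc Jc (j + 1) a b z)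
    (htr : ∀ (j : ℕ) (a b : Fin 4) (z : Fin 4 → ℤ),
      𝒦F (j + 1) a b z = (Lc : ℝ) ^ 8 * dressedEntry (wStep Lc (j + 1)) (𝒦N j) ((Lc : ℤ) • z) a b)
    (hG : ∀ j : ℕ, 1 ≤ j → ∀ (a b : Fin 4) (z : Fin 4 → ℤ),
      𝒦G j a b z = TbalOf Lc (JsB12CombShSym hLc N (symTablesAn1S2 3 Lc cΛ) cΛ cB) j a b z)
    (hT0 : ∀ j (c e : Fin 4), HasSum (TbalOf Lc (JsB12CombShSym hLc N (symTablesAn1S2 3 Lc cΛ) cΛ cB) j c e) 0)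
    (hT1 : ∀ j (c e ρ : Fin 4), HasSum (fun t : Fin 4 → ℤ => t ρ • TbalOf Lc (JsB12CombShSym hLc N (symTablesAn1S2 3 Lc cΛ) cΛ cB) j c e t) 0) :
    D1Tel Lc (JsB12CombShSym hLc N (symTablesAn1S2 3 Lc cΛ) cΛ cB) Jc := by
  refine d1Tel_anchored_of_kernel_laws_wStep hLc N cΛ cB Jc hJc1 𝒦N 𝒦F 𝒦G hlaw (fun j _ => hN j) ?_ hG hT0 hT1
  intro j hj
  match j, hj with
  | j + 1, _ => exact fineId_of_transport_of_oneShotId (𝒯 := TshotOf Lc Jc) (w := wStep Lc) 𝒦N 𝒦F j (hN j) (htr j)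

variable {FN FF FG : Type*} [Fintype FN] [Fintype FF] [Fintype FG]

/-- [folklore] **THE SAME IN `hessKer` CURRENCY** (the road's END as ONE term once #42a's law per storey, an2's `hN` from storey 0, §2's transport clause from
storey 0 at the bond-unit column and the row's `hG` are in): three independent lattice one-loop systems per storey ⟹ M‴'s `htel` at the anchored `Jc`. -/
theorem d1Tel_anchored_of_hessKer_laws_anchored_wStep (hLc : Odd Lc) (N : ℕ) (cΛ cB : ℝ) (Jc : ∀ m : ℕ, JetData 3 (Lc ^ m))
    (hJc1 : Jc 1 = JcOf hLc N (fun _ => cΛ) (fun _ => cB) 1)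
    (AN : ℕ → MKer 4 FN) (𝒱N : ℕ → Fin 4 → (Fin 4 → ℤ) → MKer 4 FN) (𝒲N : ℕ → Fin 4 → (Fin 4 → ℤ) → Fin 4 → (Fin 4 → ℤ) → MKer 4 FN)
    (AF : ℕ → MKer 4 FF) (𝒱F : ℕ → Fin 4 → (Fin 4 → ℤ) → MKer 4 FF) (𝒲F : ℕ → Fin 4 → (Fin 4 → ℤ) → Fin 4 → (Fin 4 → ℤ) → MKer 4 FF)
    (AG : ℕ → MKer 4 FG) (𝒱G : ℕ → Fin 4 → (Fin 4 → ℤ) → MKer 4 FG) (𝒲G : ℕ → Fin 4 → (Fin 4 → ℤ) → Fin 4 → (Fin 4 → ℤ) → MKer 4 FG)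
    (hlaw : ∀ j : ℕ, 1 ≤ j → ∀ (μ ν : Fin 4) (z : Fin 4 → ℤ),
      hessKer (AN j) (𝒱N j) (𝒲N j) μ ν z = hessKer (AF j) (𝒱F j) (𝒲F j) μ ν z + hessKer (AG j) (𝒱G j) (𝒲G j) μ ν z)
    (hN : ∀ (j : ℕ) (μ ν : Fin 4) (z : Fin 4 → ℤ), hessKer (AN j) (𝒱N j) (𝒲N j) μ ν z = TshotOf Lc Jc (j + 1) μ ν z)
    (htr : ∀ (j : ℕ) (μ ν : Fin 4) (z : Fin 4 → ℤ),
      hessKer (AF (j + 1)) (𝒱F (j + 1)) (𝒲F (j + 1)) μ ν z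
        = (Lc : ℝ) ^ 8 * dressedEntry (wStep Lc (j + 1)) (hessKer (AN j) (𝒱N j) (𝒲N j)) ((Lc : ℤ) • z) μ ν)
    (hG : ∀ j : ℕ, 1 ≤ j → ∀ (μ ν : Fin 4) (z : Fin 4 → ℤ),
      hessKer (AG j) (𝒱G j) (𝒲G j) μ ν z = TbalOf Lc (JsB12CombShSym hLc N (symTablesAn1S2 3 Lc cΛ) cΛ cB) j μ ν z)
    (hT0 : ∀ j (c e : Fin 4), HasSum (TbalOf Lc (JsB12CombShSym hLc N (symTablesAn1S2 3 Lc cΛ) cΛ cB) j c e) 0)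
    (hT1 : ∀ j (c e ρ : Fin 4), HasSum (fun t : Fin 4 → ℤ => t ρ • TbalOf Lc (JsB12CombShSym hLc N (symTablesAn1S2 3 Lc cΛ) cΛ cB) j c e t) 0) :
    D1Tel Lc (JsB12CombShSym hLc N (symTablesAn1S2 3 Lc cΛ) cΛ cB) Jc :=
  d1Tel_anchored_of_kernel_laws_anchored_wStep hLc N cΛ cB Jc hJc1 (fun j => hessKer (AN j) (𝒱N j) (𝒲N j))
    (fun j => hessKer (AF j) (𝒱F j) (𝒲F j)) (fun j => hessKer (AG j) (𝒱G j) (𝒲G j)) hlaw hN htr hG hT0 hT1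

end LiteralAnchored

end Summit.QuantumFields.BalabanUV.Beta.FP.StepRecursionFeedNested

end
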